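import Summits.Ventures.CertifiedManyBodySolver.Upper.BernoulliProductMixture
import Literature.MathematicalPhysics.QuantumLattice.SlaterWindowReducedDensityMatrix
import HarnessLib

/-!
# Ventures/CertifiedManyBodySolver — Upper/BlochDecorrelation.lean

HONEST FRAMING: first certified bounds; not a superconductivity verdict; every number certified or labelled float.

DECORRELATION OF THE BLOCH ENTRIES UNDER THE PRODUCT-BERNOULLI MIXTURE (sr-mbsolver L3 engine seat E1; part 2 of step D2 of the
Lean route for the plaquette-dressed translation-invariant quasi-free uppers, eng-1/LEAN-GLUE-QF.md §4; theorem-only, no certificate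
value appears, nothing is claimed). Setting of `HartreeFockBlochTorus` / `HartreeFockBlochMixture`: a family of cell-momentum blocks
`Q σ κ` (Hermitian, spectra in `[0,1]`), the all-released members `F^E σ κ = bernoulliProj (Q σ κ) (E (σ, κ))` of a pattern
`E : spin × momentum → (cell → Bool)` (`= HartreeFockBlochMixture.mixFamily Q hQh ∅ E`, by `simp [mixFamily]`) with the product weight
`W(E) = Π_{σ,κ} w_{Q σ κ}(E (σ,κ))` of `Upper/BernoulliProductMixture.lean`, and the torus one-body matrices
`P_E = spinBlock (σ ↦ blochMatrix F^E_σ)`, `P_Q = spinBlock (σ ↦ blochMatrix Q_σ)`.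
* **`norm_sum_prodWeight_mul_prod_blochMatrix_sub_le`**: for `r = |ι|` entries,
  `‖Σ_E W(E) Π_m P_{F^E}(x_m, y_m) − Π_m P_Q(x_m, y_m)‖ ≤ 2 r (r−1) / |k|` (`|k|` = number of cells). Proof: a product of `r` Bloch
  entries is `|k|^{-r} Σ_{κ : ι → cells}(phases)Π_m(block (σ_m, κ_m) entry)` (`prod_blochMatrix_apply`); momentum tuples WITHOUT
  coincidence index distinct blocks, where the mixed moment equals the product of the `Q`-entries exactly (independence + marginals,
  `norm_moment_sub_prod_le`); tuples with a coincidence `κ_a = κ_b` number `|k|^{r−1}` per ordered pair (`card_mul_sum_ite_apply_eq`) and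
  each carries a defect of modulus `≤ 2`;
* the same for spin-orbital entries (`…_spinBlock_sub_le`) and for DETERMINANTS of `r × r` matrices of such entries (`…_det_sub_le`,
  factor `r!`);
* **`norm_sum_prodWeight_mul_slaterRDM_sub_le`**, **`norm_sum_prodWeight_mul_windowObservable_sub_le`**: for a window
  `f : Orb Λ₀ → Orb Λ` of `w` orbitals and any coefficient matrix `X` on window configurations (e.g. `X = uᴴ h u`, a dressed cluster term),
  `‖Σ_E W(E) Σ_{s,t} X_{st} ρ^f_{P_E}(s,t) − Σ_{s,t} X_{st} ρ^f_{P_Q}(s,t)‖ ≤ (Σ_{s,t}|X_{st}|) · 2^w · w! · 2w² / |k|` with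
  `ρ^f_P = slaterRDM (P|_f)` the tree's window reduced density matrix (`SlaterWindowReducedDensityMatrix`).
Use: every member `P_E` is an orthogonal projection, so the tree's plaquette-dressed Slater bound `PlaquetteLUC.groundEnergyAt_le_dressed`
applies to it and is LINEAR in the `ρ^f_{P_E}`; averaging over `W` and this file replace the mixture by the (non-idempotent, certified)
reference `P_Q` up to `O(1/|k|)`, which vanishes along the thermodynamic limit `|k| → ∞` — the only non-affine step of the dressed route.
Not here: the member energy bound, cell periodicity of the cluster sum, identification with certificate data, the limit (separate files).
Sources: Lieb 1981 eq. (4) [Lieb1981]; Bach–Lieb–Solovej 1994 Thm 2.3, eq. (3a.2) [BachLiebSolovej1994]. Everything is proved; no definition.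
-/

noncomputable section

namespace Summit.Ventures.CertifiedManyBodySolver.Upper

open Matrix Finset
open Literature.MathematicalPhysics.QuantumLattice Literature.MathematicalPhysics.QuantumLattice.HartreeFock HubbardWave0
open scoped ComplexOrder ComplexConjugate

variable {d L : ℕ} {k M : Fin d → ℕ} [∀ i, NeZero (k i)] [∀ i, NeZero (M i)]

/-! ### §1. Decorrelation of products of Bloch entries -/

/-- **Decorrelation of the Bloch entries.** For the product-Bernoulli mixture over ALL blocks `(σ, κ)` of a family `Q σ κ` with spectra
in `[0,1]`: the `W`-average of a product of `r = |ι|` entries of the members' Bloch matrices differs from the same product of entries of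
the Bloch matrices of `Q` by at most `2 r (r-1) / |k|`. [folklore] -/
theorem norm_sum_prodWeight_mul_prod_blochMatrix_sub_le (hkM : ∀ i, k i * M i = L)
    (Q : Fin 2 → RectTorusSite k → Matrix (RectTorusSite M) (RectTorusSite M) ℂ) (hQh : ∀ σ κ, (Q σ κ).IsHermitian)
    (h0 : ∀ σ κ i, 0 ≤ (hQh σ κ).eigenvalues i) (h1 : ∀ σ κ i, (hQh σ κ).eigenvalues i ≤ 1)
    {ι : Type*} [Fintype ι] [DecidableEq ι] (σ : ι → Fin 2) (x y : ι → FermionTorus d L) :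
    ‖(∑ E : Fin 2 × RectTorusSite k → RectTorusSite M → Bool,
        (∏ b : Fin 2 × RectTorusSite k, (bernoulliWeight (hQh b.1 b.2) (E b) : ℂ)) *
          ∏ m, blochMatrix hkM (fun κ => bernoulliProj (hQh (σ m) κ) (E (σ m, κ))) (x m) (y m)) -
        ∏ m, blochMatrix hkM (Q (σ m)) (x m) (y m)‖ ≤
      2 * (Fintype.card ι : ℝ) * ((Fintype.card ι : ℝ) - 1) / (Fintype.card (RectTorusSite k) : ℝ) := by
  classical
  have hcR : (0 : ℝ) < (Fintype.card (RectTorusSite k) : ℝ) := by exact_mod_cast Fintype.card_pos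
  obtain ⟨c, hc⟩ : ∃ c : ℂ, c = (Fintype.card (RectTorusSite k) : ℂ) := ⟨_, rfl⟩
  obtain ⟨p, hp⟩ : ∃ p : ι → RectTorusSite M, p = fun m => cellPos hkM (x m) := ⟨_, rfl⟩
  obtain ⟨q, hq⟩ : ∃ q : ι → RectTorusSite M, q = fun m => cellPos hkM (y m) := ⟨_, rfl⟩
  obtain ⟨ph, hph⟩ : ∃ ph : (ι → RectTorusSite k) → ℂ,
      ph = fun κ => ∏ m, blockChar (κ m) (cellIndex hkM (x m) - cellIndex hkM (y m)) := ⟨_, rfl⟩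
  obtain ⟨W, hW⟩ : ∃ W : (Fin 2 × RectTorusSite k → RectTorusSite M → Bool) → ℂ,
      W = fun E => ∏ b : Fin 2 × RectTorusSite k, (bernoulliWeight (hQh b.1 b.2) (E b) : ℂ) := ⟨_, rfl⟩
  obtain ⟨memb, hmemb⟩ : ∃ memb : (Fin 2 × RectTorusSite k → RectTorusSite M → Bool) → (ι → RectTorusSite k) → ℂ,
      memb = fun E κ => ∏ m, bernoulliProj (hQh (σ m) (κ m)) (E (σ m, κ m)) (p m) (q m) := ⟨_, rfl⟩
  obtain ⟨bar, hbarr⟩ : ∃ bar : (ι → RectTorusSite k) → ℂ, bar = fun κ => ∏ m, Q (σ m) (κ m) (p m) (q m) := ⟨_, rfl⟩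
  obtain ⟨D, hD⟩ : ∃ D : (ι → RectTorusSite k) → ℂ, D = fun κ => (∑ E, W E * memb E κ) - bar κ := ⟨_, rfl⟩
  have hWE : ∀ E : Fin 2 × RectTorusSite k → RectTorusSite M → Bool,
      (∏ b : Fin 2 × RectTorusSite k, (bernoulliWeight (hQh b.1 b.2) (E b) : ℂ)) = W E := fun E => by rw [hW]
  simp_rw [hWE]
  -- Step 1: expansion in cell momenta
  have hmem : ∀ E : Fin 2 × RectTorusSite k → RectTorusSite M → Bool,
      ∏ m, blochMatrix hkM (fun κ => bernoulliProj (hQh (σ m) κ) (E (σ m, κ))) (x m) (y m) =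
        (c⁻¹) ^ Fintype.card ι * ∑ κ : ι → RectTorusSite k, ph κ * memb E κ := by
    intro E
    rw [prod_blochMatrix_apply hkM (fun m κ => bernoulliProj (hQh (σ m) κ) (E (σ m, κ))) x y, hc, hph, hmemb, hp, hq]
  have hbar : ∏ m, blochMatrix hkM (Q (σ m)) (x m) (y m) = (c⁻¹) ^ Fintype.card ι * ∑ κ : ι → RectTorusSite k, ph κ * bar κ := by
    rw [prod_blochMatrix_apply hkM (fun m => Q (σ m)) x y, hc, hph, hbarr, hp, hq]
  have hdiff : (∑ E, W E * ∏ m, blochMatrix hkM (fun κ => bernoulliProj (hQh (σ m) κ) (E (σ m, κ))) (x m) (y m)) -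
      ∏ m, blochMatrix hkM (Q (σ m)) (x m) (y m) = (c⁻¹) ^ Fintype.card ι * ∑ κ : ι → RectTorusSite k, ph κ * D κ := by
    simp_rw [hmem]
    rw [hbar]
    have hswap : ∑ E, W E * ((c⁻¹) ^ Fintype.card ι * ∑ κ : ι → RectTorusSite k, ph κ * memb E κ) =
        (c⁻¹) ^ Fintype.card ι * ∑ κ : ι → RectTorusSite k, ph κ * ∑ E, W E * memb E κ := by
      rw [Finset.mul_sum]
      simp_rw [Finset.mul_sum]
      rw [Finset.sum_comm]
      exact Finset.sum_congr rfl fun κ _ => Finset.sum_congr rfl fun E _ => by ring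
    rw [hswap, ← mul_sub, ← Finset.sum_sub_distrib]
    congr 1
    exact Finset.sum_congr rfl fun κ _ => by rw [hD, mul_sub]
  rw [hdiff]
  -- Step 2: the defect of one momentum tuple is `0` without coincidences and `≤ 2` with
  have hDle : ∀ κ : ι → RectTorusSite k,
      ‖D κ‖ ≤ 2 * ∑ pr ∈ (Finset.univ : Finset ι).offDiag, (if κ pr.1 = κ pr.2 then (1 : ℝ) else 0) := by
    intro κ
    have hmom := norm_moment_sub_prod_le (fun b : Fin 2 × RectTorusSite k => hQh b.1 b.2)
      (fun b i => h0 b.1 b.2 i) (fun b i => h1 b.1 b.2 i) (fun m => (σ m, κ m)) p q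
    have hDκ : D κ = (∑ E : Fin 2 × RectTorusSite k → RectTorusSite M → Bool,
        (∏ b : Fin 2 × RectTorusSite k, (bernoulliWeight (hQh b.1 b.2) (E b) : ℂ)) *
        ∏ m, bernoulliProj (hQh (σ m) (κ m)) (E (σ m, κ m)) (p m) (q m)) - ∏ m, Q (σ m) (κ m) (p m) (q m) := by
      rw [hD, hW, hmemb, hbarr]
    rw [hDκ]
    refine hmom.trans ?_
    have hnn : ∀ pr ∈ (Finset.univ : Finset ι).offDiag, 0 ≤ (if κ pr.1 = κ pr.2 then (1 : ℝ) else 0) := fun pr _ => by positivity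
    split_ifs with hinj
    · exact mul_nonneg zero_le_two (Finset.sum_nonneg hnn)
    · obtain ⟨a, b, hfab, hne⟩ := Function.not_injective_iff.1 hinj
      have hκ : κ a = κ b := congrArg Prod.snd hfab
      have hmemab : (a, b) ∈ (Finset.univ : Finset ι).offDiag := by simp [Finset.mem_offDiag, hne]
      have hone : (1 : ℝ) ≤ ∑ pr ∈ (Finset.univ : Finset ι).offDiag, (if κ pr.1 = κ pr.2 then (1 : ℝ) else 0) := by
        simpa [hκ] using Finset.single_le_sum hnn hmemab
      linarith
  -- Step 3: summing the defects over all momentum tuples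
  have hcount : ∑ κ : ι → RectTorusSite k, ∑ pr ∈ (Finset.univ : Finset ι).offDiag, (if κ pr.1 = κ pr.2 then (1 : ℝ) else 0) =
      ((Finset.univ : Finset ι).offDiag.card : ℝ) *
        ((Fintype.card (RectTorusSite k) : ℝ) ^ Fintype.card ι / (Fintype.card (RectTorusSite k) : ℝ)) := by
    rw [Finset.sum_comm]
    have hin : ∀ pr ∈ (Finset.univ : Finset ι).offDiag, ∑ κ : ι → RectTorusSite k, (if κ pr.1 = κ pr.2 then (1 : ℝ) else 0) =
        (Fintype.card (RectTorusSite k) : ℝ) ^ Fintype.card ι / (Fintype.card (RectTorusSite k) : ℝ) := by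
      intro pr hpr
      rw [Finset.mem_offDiag] at hpr
      rw [eq_div_iff hcR.ne', mul_comm]
      exact card_mul_sum_ite_apply_eq (K := RectTorusSite k) (Ne.symm hpr.2.2)
    rw [Finset.sum_congr rfl hin, Finset.sum_const, nsmul_eq_mul]
  have hsumD : ∑ κ : ι → RectTorusSite k, ‖D κ‖ ≤ 2 * (((Finset.univ : Finset ι).offDiag.card : ℝ) *
      ((Fintype.card (RectTorusSite k) : ℝ) ^ Fintype.card ι / (Fintype.card (RectTorusSite k) : ℝ))) := by
    rw [← hcount, Finset.mul_sum]
    exact Finset.sum_le_sum fun κ _ => hDle κ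
  -- Step 4: assemble
  have hphn : ∀ κ : ι → RectTorusSite k, ‖ph κ‖ = 1 := fun κ => by
    rw [hph]
    simp only [norm_prod, norm_blockChar, Finset.prod_const_one]
  have hcn : ‖(c⁻¹) ^ Fintype.card ι‖ = ((Fintype.card (RectTorusSite k) : ℝ) ^ Fintype.card ι)⁻¹ := by
    rw [norm_pow, norm_inv, hc, Complex.norm_natCast, inv_pow]
  have hoff : ((Finset.univ : Finset ι).offDiag.card : ℝ) = (Fintype.card ι : ℝ) * (Fintype.card ι : ℝ) - (Fintype.card ι : ℝ) := by
    rw [Finset.offDiag_card, Finset.card_univ, Nat.cast_sub (Nat.le_mul_self _), Nat.cast_mul]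
  calc ‖(c⁻¹) ^ Fintype.card ι * ∑ κ : ι → RectTorusSite k, ph κ * D κ‖
      ≤ ‖(c⁻¹) ^ Fintype.card ι‖ * ∑ κ : ι → RectTorusSite k, ‖ph κ * D κ‖ := by
        rw [norm_mul]
        gcongr
        exact norm_sum_le _ _
    _ = ((Fintype.card (RectTorusSite k) : ℝ) ^ Fintype.card ι)⁻¹ * ∑ κ : ι → RectTorusSite k, ‖D κ‖ := by
        rw [hcn]
        congr 1
        exact Finset.sum_congr rfl fun κ _ => by rw [norm_mul, hphn, one_mul]
    _ ≤ ((Fintype.card (RectTorusSite k) : ℝ) ^ Fintype.card ι)⁻¹ * (2 * (((Finset.univ : Finset ι).offDiag.card : ℝ) *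
          ((Fintype.card (RectTorusSite k) : ℝ) ^ Fintype.card ι / (Fintype.card (RectTorusSite k) : ℝ)))) := by
        gcongr
    _ = 2 * (Fintype.card ι : ℝ) * ((Fintype.card ι : ℝ) - 1) / (Fintype.card (RectTorusSite k) : ℝ) := by
        rw [hoff]
        have hpow : (Fintype.card (RectTorusSite k) : ℝ) ^ Fintype.card ι ≠ 0 := pow_ne_zero _ hcR.ne'
        field_simp

/-! ### §2. Spin-orbitals and determinants -/

/-- **Decorrelation at the level of spin-orbitals**: the same bound for products of entries of the collinear torus one-body matrices
`spinBlock (σ ↦ blochMatrix …)` at arbitrary orbital pairs. [folklore] -/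
theorem norm_sum_prodWeight_mul_prod_spinBlock_sub_le (hkM : ∀ i, k i * M i = L)
    (Q : Fin 2 → RectTorusSite k → Matrix (RectTorusSite M) (RectTorusSite M) ℂ) (hQh : ∀ σ κ, (Q σ κ).IsHermitian)
    (h0 : ∀ σ κ i, 0 ≤ (hQh σ κ).eigenvalues i) (h1 : ∀ σ κ i, (hQh σ κ).eigenvalues i ≤ 1)
    {ι : Type*} [Fintype ι] [DecidableEq ι] (a a' : ι → Orb (FermionTorus d L)) :
    ‖(∑ E : Fin 2 × RectTorusSite k → RectTorusSite M → Bool,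
        (∏ b : Fin 2 × RectTorusSite k, (bernoulliWeight (hQh b.1 b.2) (E b) : ℂ)) *
          ∏ m, spinBlock (fun σ => blochMatrix hkM (fun κ => bernoulliProj (hQh σ κ) (E (σ, κ)))) (a m) (a' m)) -
        ∏ m, spinBlock (fun σ => blochMatrix hkM (Q σ)) (a m) (a' m)‖ ≤
      2 * (Fintype.card ι : ℝ) * ((Fintype.card ι : ℝ) - 1) / (Fintype.card (RectTorusSite k) : ℝ) := by
  by_cases hsp : ∀ m, (ofLex (a m)).2 = (ofLex (a' m)).2
  · have hE : ∀ G : Fin 2 → RectTorusSite k → Matrix (RectTorusSite M) (RectTorusSite M) ℂ,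
        ∏ m, spinBlock (fun σ => blochMatrix hkM (G σ)) (a m) (a' m) =
          ∏ m, blochMatrix hkM (G (ofLex (a m)).2) (ofLex (a m)).1 (ofLex (a' m)).1 := fun G =>
      Finset.prod_congr rfl fun m _ => by simp only [spinBlock, Matrix.of_apply, if_pos (hsp m)]
    simp_rw [hE]
    exact norm_sum_prodWeight_mul_prod_blochMatrix_sub_le hkM Q hQh h0 h1
      (fun m => (ofLex (a m)).2) (fun m => (ofLex (a m)).1) (fun m => (ofLex (a' m)).1)
  · push Not at hsp
    obtain ⟨m, hm⟩ := hsp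
    have hE : ∀ G : Fin 2 → RectTorusSite k → Matrix (RectTorusSite M) (RectTorusSite M) ℂ,
        ∏ m, spinBlock (fun σ => blochMatrix hkM (G σ)) (a m) (a' m) = 0 := fun G =>
      Finset.prod_eq_zero (Finset.mem_univ m) (by simp only [spinBlock, Matrix.of_apply, if_neg hm])
    simp_rw [hE]
    simp only [mul_zero, Finset.sum_const_zero, sub_zero, norm_zero]
    exact div_nonneg (by nlinarith [natCast_mul_sub_one_nonneg (Fintype.card ι)]) (Nat.cast_nonneg _)

/-- **Decorrelation of determinants**: for `r × r` matrices whose `(i,j)` entries are entries of the torus one-body matrix at prescribed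
orbital pairs `(ρ i j, ρ' i j)`, the `W`-average of the member determinants differs from the determinant for `Q` by at most
`r! · 2 r (r-1) / |k|`. [folklore] -/
theorem norm_sum_prodWeight_mul_det_sub_le (hkM : ∀ i, k i * M i = L)
    (Q : Fin 2 → RectTorusSite k → Matrix (RectTorusSite M) (RectTorusSite M) ℂ) (hQh : ∀ σ κ, (Q σ κ).IsHermitian)
    (h0 : ∀ σ κ i, 0 ≤ (hQh σ κ).eigenvalues i) (h1 : ∀ σ κ i, (hQh σ κ).eigenvalues i ≤ 1)
    {r : ℕ} (ρ ρ' : Fin r → Fin r → Orb (FermionTorus d L)) :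
    ‖(∑ E : Fin 2 × RectTorusSite k → RectTorusSite M → Bool,
        (∏ b : Fin 2 × RectTorusSite k, (bernoulliWeight (hQh b.1 b.2) (E b) : ℂ)) *
          (Matrix.of fun i j => spinBlock (fun σ => blochMatrix hkM (fun κ => bernoulliProj (hQh σ κ) (E (σ, κ)))) (ρ i j) (ρ' i j)).det) -
        (Matrix.of fun i j => spinBlock (fun σ => blochMatrix hkM (Q σ)) (ρ i j) (ρ' i j)).det‖ ≤
      (r.factorial : ℝ) * (2 * (r : ℝ) * ((r : ℝ) - 1) / (Fintype.card (RectTorusSite k) : ℝ)) := by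
  -- abbreviate the weights and the two kinds of products
  obtain ⟨W, hW⟩ : ∃ W : (Fin 2 × RectTorusSite k → RectTorusSite M → Bool) → ℂ,
      W = fun E => ∏ b : Fin 2 × RectTorusSite k, (bernoulliWeight (hQh b.1 b.2) (E b) : ℂ) := ⟨_, rfl⟩
  obtain ⟨PE, hPE⟩ : ∃ PE : (Fin 2 × RectTorusSite k → RectTorusSite M → Bool) → Equiv.Perm (Fin r) → ℂ,
      PE = fun E π => ∏ i, spinBlock (fun σ => blochMatrix hkM (fun κ => bernoulliProj (hQh σ κ) (E (σ, κ)))) (ρ (π i) i) (ρ' (π i) i) :=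
    ⟨_, rfl⟩
  obtain ⟨PQ, hPQ⟩ : ∃ PQ : Equiv.Perm (Fin r) → ℂ, PQ = fun π => ∏ i, spinBlock (fun σ => blochMatrix hkM (Q σ)) (ρ (π i) i) (ρ' (π i) i) :=
    ⟨_, rfl⟩
  have hδ : ∀ π : Equiv.Perm (Fin r), ‖(∑ E, W E * PE E π) - PQ π‖ ≤ 2 * (r : ℝ) * ((r : ℝ) - 1) / (Fintype.card (RectTorusSite k) : ℝ) := by
    intro π
    rw [hW, hPE, hPQ]
    simpa only [Fintype.card_fin] using norm_sum_prodWeight_mul_prod_spinBlock_sub_le hkM Q hQh h0 h1 (fun i => ρ (π i) i) (fun i => ρ' (π i) i)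
  have hWE : ∀ E : Fin 2 × RectTorusSite k → RectTorusSite M → Bool,
      (∏ b : Fin 2 × RectTorusSite k, (bernoulliWeight (hQh b.1 b.2) (E b) : ℂ)) = W E := fun E => by rw [hW]
  have hPEe : ∀ (E : Fin 2 × RectTorusSite k → RectTorusSite M → Bool) (π : Equiv.Perm (Fin r)),
      ∏ i, spinBlock (fun σ => blochMatrix hkM (fun κ => bernoulliProj (hQh σ κ) (E (σ, κ)))) (ρ (π i) i) (ρ' (π i) i) = PE E π :=
    fun E π => by rw [hPE]
  have hPQe : ∀ π : Equiv.Perm (Fin r), ∏ i, spinBlock (fun σ => blochMatrix hkM (Q σ)) (ρ (π i) i) (ρ' (π i) i) = PQ π :=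
    fun π => by rw [hPQ]
  simp_rw [Matrix.det_apply', Matrix.of_apply, hWE, hPEe, hPQe]
  have hs : ∀ π : Equiv.Perm (Fin r), ‖(((Equiv.Perm.sign π : ℤˣ) : ℤ) : ℂ)‖ = 1 := fun π => by
    rcases Int.units_eq_one_or (Equiv.Perm.sign π) with h | h <;> simp [h]
  calc ‖(∑ E, W E * ∑ π : Equiv.Perm (Fin r), (((Equiv.Perm.sign π : ℤˣ) : ℤ) : ℂ) * PE E π) -
        ∑ π : Equiv.Perm (Fin r), (((Equiv.Perm.sign π : ℤˣ) : ℤ) : ℂ) * PQ π‖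
      ≤ ∑ π : Equiv.Perm (Fin r), ‖(((Equiv.Perm.sign π : ℤˣ) : ℤ) : ℂ)‖ *
          (2 * (r : ℝ) * ((r : ℝ) - 1) / (Fintype.card (RectTorusSite k) : ℝ)) :=
        norm_avg_linear_sub_le Finset.univ W _ PE PQ _ fun π _ => hδ π
    _ = (r.factorial : ℝ) * (2 * (r : ℝ) * ((r : ℝ) - 1) / (Fintype.card (RectTorusSite k) : ℝ)) := by
        simp_rw [hs, one_mul]
        rw [Finset.sum_const, Finset.card_univ, Fintype.card_perm, Fintype.card_fin, nsmul_eq_mul]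

/-! ### §3. Window reduced density matrices and window observables -/

/-- **Decorrelation of the window reduced density matrices**: for a window `f : Orb Λ₀ → Orb Λ` of `w = |Orb Λ₀|` orbitals, every entry
`ρ(s,t)` of the Slater reduced density matrix (`slaterRDM`, an alternating sum of `≤ 2^w` determinants of size `≤ w` in the window
entries) averages over the product-Bernoulli mixture to within `2^w · w! · 2w² / |k|` of the entry computed from the Bloch matrix of `Q`.
[folklore] -/
theorem norm_sum_prodWeight_mul_slaterRDM_sub_le (hkM : ∀ i, k i * M i = L)
    (Q : Fin 2 → RectTorusSite k → Matrix (RectTorusSite M) (RectTorusSite M) ℂ) (hQh : ∀ σ κ, (Q σ κ).IsHermitian)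
    (h0 : ∀ σ κ i, 0 ≤ (hQh σ κ).eigenvalues i) (h1 : ∀ σ κ i, (hQh σ κ).eigenvalues i ≤ 1)
    {Λ₀ : Type*} [LinearOrder Λ₀] [Fintype Λ₀] (f : Orb Λ₀ → Orb (FermionTorus d L)) (s t : Finset (Orb Λ₀)) :
    ‖(∑ E : Fin 2 × RectTorusSite k → RectTorusSite M → Bool,
        (∏ b : Fin 2 × RectTorusSite k, (bernoulliWeight (hQh b.1 b.2) (E b) : ℂ)) *
          slaterRDM ((spinBlock (fun σ => blochMatrix hkM (fun κ => bernoulliProj (hQh σ κ) (E (σ, κ))))).submatrix f f) s t) -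
        slaterRDM ((spinBlock (fun σ => blochMatrix hkM (Q σ))).submatrix f f) s t‖ ≤
      2 ^ Fintype.card (Orb Λ₀) * ((Fintype.card (Orb Λ₀)).factorial *
        (2 * (Fintype.card (Orb Λ₀) : ℝ) ^ 2 / (Fintype.card (RectTorusSite k) : ℝ))) := by
  have hcR : (0 : ℝ) < (Fintype.card (RectTorusSite k) : ℝ) := by exact_mod_cast Fintype.card_pos
  by_cases hst : s.card = t.card
  · simp only [slaterRDM, dif_pos hst, Matrix.submatrix_apply]
    refine (norm_avg_linear_sub_le ((s ∪ t)ᶜ).powerset _ (fun T => (-1 : ℂ) ^ T.card) _ _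
      (fun _ => ((Fintype.card (Orb Λ₀)).factorial : ℝ) * (2 * (Fintype.card (Orb Λ₀) : ℝ) ^ 2 / (Fintype.card (RectTorusSite k) : ℝ)))
      fun T hT => ?_).trans ?_
    · -- one determinant of size `#t + #T ≤ w`
      rw [Finset.mem_powerset] at hT
      have hdisj : Disjoint t T := Finset.disjoint_left.2 fun a hat haT => by
        have := hT haT
        rw [Finset.mem_compl, Finset.mem_union] at this
        exact this (Or.inr hat)
      have hn : t.card + T.card ≤ Fintype.card (Orb Λ₀) := by
        rw [← Finset.card_union_of_disjoint hdisj]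
        exact Finset.card_le_univ _
      exact (norm_sum_prodWeight_mul_det_sub_le hkM Q hQh h0 h1 _ _).trans (det_const_mono hn hcR)
    · -- at most `2^w` determinants
      have hpow : ((2 ^ ((s ∪ t)ᶜ).card : ℕ) : ℝ) ≤ 2 ^ Fintype.card (Orb Λ₀) := by
        rw [Nat.cast_pow, Nat.cast_ofNat]
        exact pow_le_pow_right₀ (by norm_num) (Finset.card_le_univ _)
      simp only [norm_pow, norm_neg, norm_one, one_pow, one_mul, Finset.sum_const, nsmul_eq_mul, Finset.card_powerset]
      exact mul_le_mul_of_nonneg_right hpow (by positivity)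
  · simp only [slaterRDM, dif_neg hst, mul_zero, Finset.sum_const_zero, sub_zero, norm_zero]
    positivity

/-- **Decorrelation of window observables.** For a window `f : Orb Λ₀ → Orb Λ` and any coefficient matrix `X` on the window configurations
(e.g. `X = uᴴ h u`, a dressed cluster Hamiltonian), written as a sum over configuration pairs, the product-Bernoulli average of the
members' Slater expectations `Σ_{(s,t)} X_{st} ρ^f_{P_E}(s,t)` differs from the same expression at the Bloch matrix of `Q` by at most
`(Σ |X_{st}|) · 2^w w! 2w² / |k|`: the error of replacing the mixture by its one-body average is `O(1/|k|)` uniformly in the torus and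
disappears in the thermodynamic limit along `|k| → ∞`. (Double sums `Σ_s Σ_t` are this by `Fintype.sum_prod_type'`.) [folklore] -/
theorem norm_sum_prodWeight_mul_windowObservable_sub_le (hkM : ∀ i, k i * M i = L)
    (Q : Fin 2 → RectTorusSite k → Matrix (RectTorusSite M) (RectTorusSite M) ℂ) (hQh : ∀ σ κ, (Q σ κ).IsHermitian)
    (h0 : ∀ σ κ i, 0 ≤ (hQh σ κ).eigenvalues i) (h1 : ∀ σ κ i, (hQh σ κ).eigenvalues i ≤ 1)
    {Λ₀ : Type*} [LinearOrder Λ₀] [Fintype Λ₀] (f : Orb Λ₀ → Orb (FermionTorus d L)) (X : Matrix (Finset (Orb Λ₀)) (Finset (Orb Λ₀)) ℂ) :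
    ‖(∑ E : Fin 2 × RectTorusSite k → RectTorusSite M → Bool,
        (∏ b : Fin 2 × RectTorusSite k, (bernoulliWeight (hQh b.1 b.2) (E b) : ℂ)) *
          ∑ st : Finset (Orb Λ₀) × Finset (Orb Λ₀), X st.1 st.2 *
            slaterRDM ((spinBlock (fun σ => blochMatrix hkM (fun κ => bernoulliProj (hQh σ κ) (E (σ, κ))))).submatrix f f) st.1 st.2) -
        ∑ st : Finset (Orb Λ₀) × Finset (Orb Λ₀), X st.1 st.2 *
          slaterRDM ((spinBlock (fun σ => blochMatrix hkM (Q σ))).submatrix f f) st.1 st.2‖ ≤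
      (∑ st : Finset (Orb Λ₀) × Finset (Orb Λ₀), ‖X st.1 st.2‖) *
        (2 ^ Fintype.card (Orb Λ₀) * ((Fintype.card (Orb Λ₀)).factorial *
          (2 * (Fintype.card (Orb Λ₀) : ℝ) ^ 2 / (Fintype.card (RectTorusSite k) : ℝ)))) := by
  obtain ⟨W, hW⟩ : ∃ W : (Fin 2 × RectTorusSite k → RectTorusSite M → Bool) → ℂ,
      W = fun E => ∏ b : Fin 2 × RectTorusSite k, (bernoulliWeight (hQh b.1 b.2) (E b) : ℂ) := ⟨_, rfl⟩
  obtain ⟨ρE, hρE⟩ : ∃ ρE : (Fin 2 × RectTorusSite k → RectTorusSite M → Bool) → Finset (Orb Λ₀) × Finset (Orb Λ₀) → ℂ, ρE = fun E st =>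
      slaterRDM ((spinBlock (fun σ => blochMatrix hkM (fun κ => bernoulliProj (hQh σ κ) (E (σ, κ))))).submatrix f f) st.1 st.2 := ⟨_, rfl⟩
  obtain ⟨ρQ, hρQ⟩ : ∃ ρQ : Finset (Orb Λ₀) × Finset (Orb Λ₀) → ℂ, ρQ = fun st =>
      slaterRDM ((spinBlock (fun σ => blochMatrix hkM (Q σ))).submatrix f f) st.1 st.2 := ⟨_, rfl⟩
  obtain ⟨C, hC⟩ : ∃ C : ℝ, C = 2 ^ Fintype.card (Orb Λ₀) * ((Fintype.card (Orb Λ₀)).factorial *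
      (2 * (Fintype.card (Orb Λ₀) : ℝ) ^ 2 / (Fintype.card (RectTorusSite k) : ℝ))) := ⟨_, rfl⟩
  have hδ : ∀ st : Finset (Orb Λ₀) × Finset (Orb Λ₀), ‖(∑ E, W E * ρE E st) - ρQ st‖ ≤ C := by
    intro st
    rw [hW, hρE, hρQ, hC]
    exact norm_sum_prodWeight_mul_slaterRDM_sub_le hkM Q hQh h0 h1 f st.1 st.2
  have hWE : ∀ E : Fin 2 × RectTorusSite k → RectTorusSite M → Bool,
      (∏ b : Fin 2 × RectTorusSite k, (bernoulliWeight (hQh b.1 b.2) (E b) : ℂ)) = W E := fun E => by rw [hW]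
  have hρEe : ∀ (E : Fin 2 × RectTorusSite k → RectTorusSite M → Bool) (st : Finset (Orb Λ₀) × Finset (Orb Λ₀)),
      slaterRDM ((spinBlock (fun σ => blochMatrix hkM (fun κ => bernoulliProj (hQh σ κ) (E (σ, κ))))).submatrix f f) st.1 st.2 = ρE E st :=
    fun E st => by rw [hρE]
  have hρQe : ∀ st : Finset (Orb Λ₀) × Finset (Orb Λ₀),
      slaterRDM ((spinBlock (fun σ => blochMatrix hkM (Q σ))).submatrix f f) st.1 st.2 = ρQ st := fun st => by rw [hρQ]
  simp_rw [hWE, hρEe, hρQe]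
  rw [← hC]
  have hlin : (∑ E, W E * ∑ st : Finset (Orb Λ₀) × Finset (Orb Λ₀), X st.1 st.2 * ρE E st) -
      ∑ st : Finset (Orb Λ₀) × Finset (Orb Λ₀), X st.1 st.2 * ρQ st =
        ∑ st : Finset (Orb Λ₀) × Finset (Orb Λ₀), X st.1 st.2 * ((∑ E, W E * ρE E st) - ρQ st) := by
    simp_rw [Finset.mul_sum]
    rw [Finset.sum_comm, ← Finset.sum_sub_distrib]
    refine Finset.sum_congr rfl fun st _ => ?_
    rw [mul_sub, Finset.mul_sum]
    congr 1
    exact Finset.sum_congr rfl fun E _ => by ring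
  rw [hlin, Finset.sum_mul]
  calc _ ≤ ∑ st : Finset (Orb Λ₀) × Finset (Orb Λ₀), ‖X st.1 st.2 * ((∑ E, W E * ρE E st) - ρQ st)‖ := norm_sum_le _ _
    _ ≤ ∑ st : Finset (Orb Λ₀) × Finset (Orb Λ₀), ‖X st.1 st.2‖ * C := Finset.sum_le_sum fun st _ => by
        rw [norm_mul]
        gcongr
        exact hδ st

end Summit.Ventures.CertifiedManyBodySolver.Upper
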